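import Mathlib
import HarnessLib
import Summits.ResolutionOfSingularities.ResolutionOfSingularities.Theorems.WildQuotientsWildQuotientResolutionS1aCuspPoints

/-!
# S1a — R4c cusp, LEVEL 1 as ONE FAMILY over `Fin 2` (`exists_cusp_pointCentre`)

[OURS · L1 W4.5c · crux stmt-ResolutionOfSingularities-17941 `CyclicQuotientFourfolds`, line `s1a-logminvertex` v13 (`stub_reachLowerInFX`); R4c cusp,
assembly step (b6) of `Lines/s1a_logminvertex-R4c-PROGRESS.md` §4 ("η = Fin 2 points with case-defined data, uniform TYPES")] — NOT a statement of the
manuscript; counted 0; AI-level work, weaker than expert review.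

✓`exists_cuspO_pointCentre` (point `O`, no recentring, weights `(9,2,3)`, both tail generators moving) and ✓`exists_cuspQ_pointCentre` (tangency point
`Q = (a, c)`, recentred by `γ_Q`, weights `(3,1,2)`) packaged as ONE statement indexed by `i : Fin 2` whose only `i`-dependence is through TABLES:
localising polynomial `hh i = ∏_{j ≠ i} N(x₁ + αᵢ − αⱼ)` (`α = (0, a)`), recentring rows `γ (x₂) = (x₂, x₂ + x₁ + c)ᵢ`, `γ⁻¹`, the `σᵢ`-rows
`σᵢ x₂ = (x₂ + x₀, x₂)ᵢ`, tails `(x₂² − x₁³, T_Q)ᵢ`, and weights `((9,2,3), (3,1,2))ᵢ` — so that the assembly `cusp_killsIn_two` can `choose` the per-point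
data exactly as ✓`graphTail_killsIn_two` does with ✓`exists_graphTail_pointCentre` (for `O`: `γ := AlgEquiv.refl`, `e_O := e`, `σ_O := σ`).
-/

set_option linter.dupNamespace false

noncomputable section

open CategoryTheory Limits AlgebraicGeometry TopologicalSpace Topology Opposite MvPolynomial
open Literature.AlgebraicGeometry.Resolution Literature.AlgebraicGeometry.RelativeSpec
open Summit.ResolutionOfSingularities.ResolutionOfSingularities.Theorems.WildQuotientResolution.S1
open Summit.ResolutionOfSingularities.ResolutionOfSingularities.Theorems.WildQuotientResolution.S1.NodeAtlas
open Summit.ResolutionOfSingularities.ResolutionOfSingularities.Theorems.WildQuotientResolution.S1.CoarseChart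
open Summit.ResolutionOfSingularities.ResolutionOfSingularities.Theorems.WildQuotientResolution.S1.ProducerStep
open Summit.ResolutionOfSingularities.ResolutionOfSingularities.Theorems.WildQuotientResolution.S1.NpFrame
open Summit.ResolutionOfSingularities.ResolutionOfSingularities.Theorems.WildQuotientResolution.S1.GoodCharts
open Summit.ResolutionOfSingularities.ResolutionOfSingularities.Theorems.WildQuotientResolution.S1.NodeAway
open Summit.ResolutionOfSingularities.ResolutionOfSingularities.Theorems.WildQuotientResolution.S1.NodeChartAway
open Summit.ResolutionOfSingularities.ResolutionOfSingularities.Theorems.WildQuotientResolution.S1.NodeTransport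
open Summit.ResolutionOfSingularities.ResolutionOfSingularities.Theorems.WildQuotientResolution.S1.CentreAway
open Summit.ResolutionOfSingularities.ResolutionOfSingularities.Theorems.WildQuotientResolution.S1.BlowupCharts
open Summit.ResolutionOfSingularities.ResolutionOfSingularities.Theorems.WildQuotientResolution.S1.KillCert

namespace Summit.ResolutionOfSingularities.ResolutionOfSingularities.Theorems.WildQuotientResolution.S1.GameFrame.GModel

variable {p : ℕ} {X' X₁ : Scheme.{0}} {q : X' ⟶ X₁} {G : Type} [Group G] {ρ : G →* Aut X'} {g₀ : G}

set_option maxHeartbeats 4000000 in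
/-- ★ **R4c LEVEL 1, both points as one `Fin 2`-family.** For `i = 0` the point `O` (✓`exists_cuspO_pointCentre`, `γ = 1`), for `i = 1` the tangency point
`Q` (✓`exists_cuspQ_pointCentre`); tables as in the module docstring. [OURS · L1 W4.5c · R4c (b6); NOT a statement of the manuscript] -/
theorem exists_cusp_pointCentre [Finite G] (hG : ∀ g : G, g ∈ Subgroup.zpowers g₀) (M : GModel p q G ρ g₀) [M.V.IsSeparated]
    (O : M.act.StableAffineOpens) (hO : IsAffineOpen O.1)
    {k : Type} [Field k] [Fact p.Prime] [CharP k p] (e : Γ(M.V, O.1) ≃+* (MvPolynomial (Fin 4) k)) (σ : (MvPolynomial (Fin 4) k) ≃+* (MvPolynomial (Fin 4) k)) (hC : ∀ a : k, σ (C a) = C a)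
    (h0 : σ (X 0) = X 0) (h1 : σ (X 1) = X 1 + X 0) (h2 : σ (X 2) = X 2 + X 0) (h3 : σ (X 3) = X 3 + (X 2 ^ 2 - X 1 ^ 3))
    (hact : ∀ t : Γ(M.V, O.1), actOEquiv M.act O g₀ t = e.symm (σ (e t))) (hσp : ∀ a : (MvPolynomial (Fin 4) k), (⇑σ)^[p] a = a)
    (hcl : ∀ S : Set Γ(M.V, O.1), IsClosed (M.V.zeroLocus (U := O.1) S ∩ (O.1 : Set M.V))) (a c : k) (ha : a ≠ 0)
    (hQ1 : 2 * c = 3 * a ^ 2) (hQ2 : c ^ 2 = a ^ 3) (i : Fin 2) :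
    ∃ (hh : (MvPolynomial (Fin 4) k)) (_ : hh = (∏ j ∈ Finset.univ.erase i, ∏ l : ZMod p, (X 1 + C ((![(0 : k), a] : Fin 2 → k) i - (![(0 : k), a] : Fin 2 → k) j) + (l.val : MvPolynomial (Fin 4) k) * X 0))) (γ : (MvPolynomial (Fin 4) k) ≃ₐ[k] (MvPolynomial (Fin 4) k)) (eQ : Γ(M.V, O.1) ≃+* (MvPolynomial (Fin 4) k)) (σQ : (MvPolynomial (Fin 4) k) ≃+* (MvPolynomial (Fin 4) k)) (hσh : σQ hh = hh)
      (hactQ : ∀ t : Γ(M.V, O.1), actOEquiv M.act O g₀ t = eQ.symm (σQ (eQ t))),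
      (∀ t, eQ t = γ (e t)) ∧
      (γ (X 0) = X 0 ∧ γ (X 1) = X 1 + C ((![(0 : k), a] : Fin 2 → k) i) ∧ γ (X 2) = (![X 2, X 2 + X 1 + C c] : Fin 2 → (MvPolynomial (Fin 4) k)) i ∧ γ (X 3) = X 3 ∧
        γ.symm (X 0) = X 0 ∧ γ.symm (X 1) = X 1 - C ((![(0 : k), a] : Fin 2 → k) i) ∧ γ.symm (X 2) = (![X 2, X 2 - X 1 + C (a - c)] : Fin 2 → (MvPolynomial (Fin 4) k)) i ∧ γ.symm (X 3) = X 3) ∧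
      ((∀ a : k, σQ (C a) = C a) ∧ σQ (X 0) = X 0 ∧ σQ (X 1) = X 1 + X 0 ∧ σQ (X 2) = (![X 2 + X 0, X 2] : Fin 2 → (MvPolynomial (Fin 4) k)) i ∧ σQ (X 3) = X 3 + (![(X 2 ^ 2 - X 1 ^ 3 : MvPolynomial (Fin 4) k), (X 2 ^ 2 + 2 * X 1 * X 2 + C (2 * c) * X 2 + C (1 - 3 * a) * X 1 ^ 2 - X 1 ^ 3 : MvPolynomial (Fin 4) k)] : Fin 2 → (MvPolynomial (Fin 4) k)) i ∧ (∀ a : (MvPolynomial (Fin 4) k), (⇑σQ)^[p] a = a)) ∧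
      ∃ (𝒜u : (Π j : Fin 0, ZMod ((![] : Fin 0 → ℕ) j)) → AddSubgroup (Localization.Away hh)) (_ : GradedRing 𝒜u) (eW : Γ(M.V, (basicOpenStable M.act O hO (actO_symm_eq_of_fixed hG M O eQ σQ hactQ hh hσh)).1) ≃+* ↥(𝒜u 0)),
        (∀ (d : (Π j : Fin 0, ZMod ((![] : Fin 0 → ℕ) j))) (x : (Localization.Away hh)), x ∈ 𝒜u d) ∧
        IsTameNode p (Localization.Away hh) 𝒜u (sigmaAway σQ hσh) ∧
        (∀ t' : Γ(M.V, (basicOpenStable M.act O hO (actO_symm_eq_of_fixed hG M O eQ σQ hactQ hh hσh)).1), ((eW ((M.act.aut g₀⁻¹).hom.appLE (basicOpenStable M.act O hO (actO_symm_eq_of_fixed hG M O eQ σQ hactQ hh hσh)).1 (basicOpenStable M.act O hO (actO_symm_eq_of_fixed hG M O eQ σQ hactQ hh hσh)).1 ((basicOpenStable M.act O hO (actO_symm_eq_of_fixed hG M O eQ σQ hactQ hh hσh)).2.1 g₀⁻¹).ge t') : ↥(𝒜u 0)) : (Localization.Away hh)) = sigmaAway σQ hσh ((eW t' : ↥(𝒜u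 0)) : (Localization.Away hh))) ∧
        (∀ t : Γ(M.V, O.1), ((eW (algebraMap Γ(M.V, O.1) Γ(M.V, M.V.basicOpen (eQ.symm hh)) t) : ↥(𝒜u 0)) : (Localization.Away hh)) = algebraMap (MvPolynomial (Fin 4) k) (Localization.Away hh) (eQ t)) ∧
        ∃ (𝒦 : ReesFiltration M.V) (d : ℕ), 0 < d ∧ IsAdmissibleCentre p M.act g₀ 𝒦 d ∧ IsCentreChart p M.act g₀ 𝒦 d (basicOpenStable M.act O hO (actO_symm_eq_of_fixed hG M O eQ σQ hactQ hh hσh)) ∧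
          (∀ (g' : G) (n : ℕ), (𝒦.ideal n).comap (M.act.aut g').hom = 𝒦.ideal n) ∧
          (∀ n, (𝒦.filtration ⟨(basicOpenStable M.act O hO (actO_symm_eq_of_fixed hG M O eQ σQ hactQ hh hσh)).1, hO.basicOpen (eQ.symm hh)⟩).ideal n = ((traceFiltration 𝒜u (fun l => algebraMap (MvPolynomial (Fin 4) k) (Localization.Away hh) (X ((![0, 1, 2] : Fin 3 → Fin 4) l))) ((![(![9, 2, 3] : Fin 3 → ℕ), (![3, 1, 2] : Fin 3 → ℕ)] : Fin 2 → (Fin 3 → ℕ)) i)).ideal n).comap (eW : Γ(M.V, (basicOpenStable M.act O hO (actO_symm_eq_of_fixed hG M O eQ σQ hactQ hh hσh)).1) →+* ↥(𝒜u 0))) ∧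
          VeroneseNormalised 𝒜u (fun l => algebraMap (MvPolynomial (Fin 4) k) (Localization.Away hh) (X ((![0, 1, 2] : Fin 3 → Fin 4) l))) ((![(![9, 2, 3] : Fin 3 → ℕ), (![3, 1, 2] : Fin 3 → ℕ)] : Fin 2 → (Fin 3 → ℕ)) i) d ∧
          (((𝒦.ideal d).support : Set M.V)) ⊆ ((basicOpenStable M.act O hO (actO_symm_eq_of_fixed hG M O eQ σQ hactQ hh hσh)).1 : Set M.V) := by
  refine Fin.cases ?_ (fun j => Fin.cases ?_ (fun l => l.elim0) j) i
  · -- the point `O`: no recentring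
    obtain ⟨hh, hhh, hσh, 𝒜u, gr, eW, hfull, htame, hσW, hpinW, 𝒦, d, hd, hadm, hchart, hG𝒦, hfil, hver, hsupp⟩ :=
      exists_cuspO_pointCentre hG M O hO e σ hC h0 h1 h2 h3 hact hσp hcl a ha
    exact ⟨hh, hhh, AlgEquiv.refl, e, σ, hσh, hact, fun t => rfl, ⟨rfl, by simp, by simp, rfl, by simp, by simp, by simp, by simp⟩,
      ⟨hC, h0, h1, h2, h3, hσp⟩, 𝒜u, gr, eW, hfull, htame, hσW, hpinW, 𝒦, d, hd, hadm, hchart, hG𝒦, hfil, hver, hsupp⟩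
  · -- the tangency point `Q`
    exact exists_cuspQ_pointCentre hG M O hO e σ hC h0 h1 h2 h3 hact hσp hcl a c ha hQ1 hQ2

/-- The localising polynomial of the family at `O` (`i = 0`) in the form taken by ✓`exists_cuspO_memberChart_rel(_xi)`:
`∏_{j ≠ 0} N(x₁ + α₀ − αⱼ) = N(x₁ − a)`. [OURS · L1 W4.5c · R4c (b6) plumbing] -/
theorem cusp_hh_zero_eq {k : Type} [Field k] (p : ℕ) [Fact p.Prime] (a : k) :
    (∏ j ∈ Finset.univ.erase (0 : Fin 2), ∏ l : ZMod p, (X 1 + C ((![(0 : k), a] : Fin 2 → k) 0 - (![(0 : k), a] : Fin 2 → k) j) + (l.val : MvPolynomial (Fin 4) k) * X 0)) =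
      ∏ l : ZMod p, (X 1 + C (-a) + (l.val : MvPolynomial (Fin 4) k) * X 0) := by
  have h : Finset.univ.erase (0 : Fin 2) = {1} := by decide
  rw [h, Finset.prod_singleton]
  simp only [Matrix.cons_val_zero, Matrix.cons_val_one, zero_sub]

/-- The localising polynomial of the family at `Q` (`i = 1`) in the form taken by ✓`exists_cuspQ_memberChart_rel` / ✓`exists_cuspQv_memberChart_rel`:
`∏_{j ≠ 1} N(x₁ + α₁ − αⱼ) = N(x₁ + a)`. [OURS · L1 W4.5c · R4c (b6) plumbing] -/
theorem cusp_hh_one_eq {k : Type} [Field k] (p : ℕ) [Fact p.Prime] (a : k) :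
    (∏ j ∈ Finset.univ.erase (1 : Fin 2), ∏ l : ZMod p, (X 1 + C ((![(0 : k), a] : Fin 2 → k) 1 - (![(0 : k), a] : Fin 2 → k) j) + (l.val : MvPolynomial (Fin 4) k) * X 0)) =
      ∏ l : ZMod p, (X 1 + C a + (l.val : MvPolynomial (Fin 4) k) * X 0) := by
  have h : Finset.univ.erase (1 : Fin 2) = {0} := by decide
  rw [h, Finset.prod_singleton]
  simp only [Matrix.cons_val_zero, Matrix.cons_val_one, sub_zero]

end Summit.ResolutionOfSingularities.ResolutionOfSingularities.Theorems.WildQuotientResolution.S1.GameFrame.GModel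

end
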